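import Mathlib

/-!
# Elementary cores of THEOREM U (DENSITY-XY G.47(d)): flag-variance bound ⟹ per-bond deficit cap

Kernel anchors for `DENSITY-XY.md` ADDENDUM G.47 (repair cell b2b-imbrie, XY / free-fermion rung).
THEOREM U there says: if every flag variance satisfies `Var(ρ_{m-1}) ≤ C_V` on the good set `B`
(CONJECTURE UV), then on an `s₀`-separated spectrum every bond deficit obeys
`e^{d_m} = E_{m-1} p_m / p_{m-1} ≤ C_V (1 + 1/c) / c` with `c = c(s₀, C_V) > 0`, whence
`K_n ≤ C_U^{n-1} n!`.  The argument is three elementary steps, checked here over `ℝ`: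

* `window_mass_lower` — Chebyshev count: if the mass outside a window is `≤ C_V / a²` and the window
  holds at most `N` atoms each of mass `≤ p`, then `p ≥ (1 - C_V/a²)/N`;
* `top_dev_sq_le` — the heaviest atom (mass `p`) lies within `√(V/p)` of the mean:
  `p (t - μ)² ≤ V` gives `(t - μ)² ≤ V / p`;
* `deficit_cap` — with `E ≤ V + V/p` (second moment about the top atom = variance + (top - mean)²),
  `V ≤ C_V`, `c ≤ p`, `p' ≤ 1`: `E p' / p ≤ C_V (1 + 1/c) / c`;
* `two_atom_var_lower` — the two-atom variance bound used for the converse direction and in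
  G.47(b): `p (x-μ)² + q (y-μ)² ≥ (p q /(p+q)) (x-y)²` for `p, q > 0` and any centre `μ`.

Elementary real algebra only; nothing here asserts UV itself or anything about the interacting chain.
-/

namespace Literature.MathematicalPhysics.QuantumLattice.Imbrie2016

/-- **Chebyshev count.**  `1 - CV/a² ≤ S` (mass inside the window), `S ≤ N * p` (at most `N` atoms of
mass `≤ p` inside), `0 < N` imply `(1 - CV/a²)/N ≤ p`.  [folklore] -/
theorem window_mass_lower (CV a S p N : ℝ) (hN : 0 < N) (hmass : 1 - CV / a ^ 2 ≤ S)
    (hS : S ≤ N * p) : (1 - CV / a ^ 2) / N ≤ p := by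
  rw [div_le_iff₀ hN]
  linarith [mul_comm N p]

/-- **Top atom near the mean.**  `p (t - μ)² ≤ V`, `0 < p` imply `(t - μ)² ≤ V / p`.  [folklore] -/
theorem top_dev_sq_le (p t μ V : ℝ) (hp : 0 < p) (h : p * (t - μ) ^ 2 ≤ V) :
    (t - μ) ^ 2 ≤ V / p := by
  rw [le_div_iff₀ hp]
  linarith [mul_comm p ((t - μ) ^ 2)]

/-- **Deficit cap (THEOREM U, algebraic core).**  If `0 < c ≤ p`, `p' ≤ 1`, `0 ≤ V ≤ CV`,
`0 ≤ E ≤ V + V / p`, then `E * p' / p ≤ CV * (1 + 1/c) / c`.  [folklore] -/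
theorem deficit_cap (c p p' V CV E : ℝ) (hc : 0 < c) (hcp : c ≤ p) (hp'1 : p' ≤ 1)
    (hV0 : 0 ≤ V) (hV : V ≤ CV) (hE0 : 0 ≤ E) (hE : E ≤ V + V / p) :
    E * p' / p ≤ CV * (1 + 1 / c) / c := by
  have hp : 0 < p := lt_of_lt_of_le hc hcp
  have hCV0 : 0 ≤ CV := le_trans hV0 hV
  -- 1/p ≤ 1/c
  have hinv : 1 / p ≤ 1 / c := one_div_le_one_div_of_le hc hcp
  -- V/p ≤ CV/c
  have h1 : V / p ≤ CV / c := by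
    calc V / p = V * (1 / p) := by ring
      _ ≤ CV * (1 / c) := by
          apply mul_le_mul hV hinv (by positivity) hCV0
      _ = CV / c := by ring
  have hEb : E ≤ CV * (1 + 1 / c) := by
    have : CV * (1 + 1 / c) = CV + CV / c := by ring
    rw [this]; linarith
  have hEp' : E * p' ≤ CV * (1 + 1 / c) := by
    calc E * p' ≤ E * 1 := by apply mul_le_mul_of_nonneg_left hp'1 hE0
      _ = E := by ring
      _ ≤ CV * (1 + 1 / c) := hEb
  have hK0 : 0 ≤ CV * (1 + 1 / c) := by positivity
  calc E * p' / p ≤ CV * (1 + 1 / c) / p := by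
        apply div_le_div_of_nonneg_right hEp' hp.le
    _ ≤ CV * (1 + 1 / c) / c := by
        apply div_le_div_of_nonneg_left hK0 hc hcp

/-- **Two-atom variance bound.**  For `p, q > 0` and any `x y μ`:
`(p q /(p + q)) (x - y)² ≤ p (x - μ)² + q (y - μ)²` — the variance of a measure is at least the
contribution of any two of its atoms, minimised over the centre.  [folklore] -/
theorem two_atom_var_lower (p q x y μ : ℝ) (hp : 0 < p) (hq : 0 < q) :
    p * q / (p + q) * (x - y) ^ 2 ≤ p * (x - μ) ^ 2 + q * (y - μ) ^ 2 := by
  have hpq : 0 < p + q := by linarith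
  rw [div_mul_eq_mul_div, div_le_iff₀ hpq]
  have key : (p * (x - μ) ^ 2 + q * (y - μ) ^ 2) * (p + q) - p * q * (x - y) ^ 2
      = (p * (x - μ) + q * (y - μ)) ^ 2 := by ring
  nlinarith [sq_nonneg (p * (x - μ) + q * (y - μ)), key]

end Literature.MathematicalPhysics.QuantumLattice.Imbrie2016
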